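import Summits.BirchSwinnertonDyer.BirchSwinnertonDyer.Theorems.ByReductionTypeAtTwoOrdKatoHalfAtTwoIsoConjATwoOfNarrowMu
import Literature.NumberTheory.IwasawaTheory.NarrowFukudaCertificateLayerModels
import HarnessLib

/-!
# Route `ByReductionTypeAtTwo`, crux `OrdKatoHalfAtTwoIso` (stmt-BirchSwinnertonDyer-19573), the `0 < Δ` cell: Coates–Sujatha's (A) at `2`
# (the Q⁺ text `FineSelmerConjATwoOrdPosDisc`, the (A)₂-half of the registered G11⁺ `stub_greenbergMu_two_posDisc` of v24) from a FINITE
# NARROW RANK CERTIFICATE of the cubic point field `ℚ(P)` — NARROW FUKUDA (kernel) + Kida-lite (GEN 8, kernel)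

`--supports stmt-BirchSwinnertonDyer-19573` file of the width seat `cruxlead-stmt-BirchSwinnertonDyer-19573-w2` GEN 9 (cell `bsd-2adic`). THEOREMS
ONLY (no definition, no named fact, no `sorry`). Closes nothing: Q⁺, G11⁺ and the crux remain OPEN; no certificate is asserted for any curve
here; BSD is not proved by any of this.

WHAT. GEN 8's kernel road `NarrowMu.conjA_two_of_narrowMu_pointField` / `NarrowMu.fineSelmerConjATwoOrdPosDisc_of_narrowMu_pointField` takes
«narrow `μ₂(ℚ(P)) = 0`» in the numerical form (a) `μ₂ = 0` for every cyclotomic `ℤ₂`-extension `κP` of `ℚ(P)` ∧ (b) `ord₂ h⁺(ℚ(P)_n) − ord₂ h(ℚ(P)_n) ≤ D`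
for ALL `n` — an `∀ n` statement about the whole tower.  This seat's Literature theorem «NARROW FUKUDA»
(`NarrowFukudaRankProofs`: Fukuda 1994 Thm. 1 (2) for the NARROW class groups, finite-level proof over the big Hilbert class field) turns
(a) ∧ (b) into a FINITE certificate (`NarrowFukuda.narrowMu_of_narrowRankCertificate`): an index `n₀` (Fukuda's: the primes above `2` ramified in
`ℚ(P)_∞/ℚ(P)` are totally ramified from the layer `n₀` on), the equality `rank₂ Cl⁺(ℚ(P)_{n₀+1}) = rank₂ Cl⁺(ℚ(P)_{n₀})`, and a bound `B` for
`rank₂ Cl⁺(ℚ(P)_m)`, `m ≤ n₀`.  For the totally real `S₃`-cubics of the `0 < Δ` cell with `n₀ = 0` this is TWO narrow class-group computations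
(`ℚ(P)` and `ℚ(P)(√2)`, degrees `3` and `6`) — «census-decidable» in the pen's sense (RC-485), exactly the quantities eng-2's `greenberg2.gp`
(`bnfnarrow` along `k_j = F·ℚ(ζ_{2^{j+2}})⁺`) tabulates; the door itself is kernel.

* §1 **`conjA_two_of_narrowRankCertificate_pointField`** — (A) at `(W, 2)` (`∃ γ D` form, every cyclotomic `κ` of `ℚ`) for `W/ℚ` elliptic and
  `P ∈ W[2] ∖ 0` with `[ℚ(P) : ℚ]` odd, from a narrow rank certificate `(n₀, B)` of `ℚ(P) = ℚ̄^{Stab P}`; ANY sign of `Δ`.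
* §2 **`fineSelmerConjATwoOrdPosDisc_of_narrowRankCertificate`** — the Q⁺ ROAD: a narrow rank certificate at SOME `P ≠ 0` of every curve of the cell
  [non-CM, `r_an = 0`, good ordinary at `2`, `ρ̄₂` onto, `0 < Δ`] ⟹ `FineSelmerConjATwoOrdPosDisc`.
* §3 **`conjA_two_cubicModel_of_narrowRankCertificate`** — the CUBIC-MODEL door for the census currency of C1″/C4″/k4
  (`y² = x³ + px² + qx + r`, irreducible, `β` a root): certificate for `ℚ(β)` ⟹ (A)₂.
* §4 the same with CONCRETE MODELS at `n₀ = 0` (`NarrowFukudaCertificateLayerModels`): `conjA_two_of_narrowRank_sqrtTwo_model_pointField`,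
  **`conjA_two_cubicModel_of_narrowRank_sqrtTwo_model`** — Fukuda index `0` for `ℚ(β)` (tree criteria) + a model `L` of `ℚ(β)(√2)` with
  `[Cl⁺(L) : Cl⁺(L)²] = [Cl⁺(ℚ(β)) : Cl⁺(ℚ(β))²]` ⟹ (A)₂: ONE equality of narrow `2`-ranks of two explicit fields (degrees `3` and `6`).

Honest scope: the certificate is a property of the number field `ℚ(P)` (Greenberg-conjecture territory: it FAILS to exist exactly when the narrow
`2`-ranks keep growing one more step at `n₀`, which does not refute narrow `μ₂ = 0`); nothing is asserted about any curve or field here.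

References: [Fukuda1994] Thm. 1 (2), p. 264; [Kida1982JFields] (μ-part; shape); [CoatesSujatha2005] Conj. A, Thm. 3.4; [Lim2017FineSelmer] §3
Thm. 3.5 / Lemma 3.2; [GreenbergLNM1716] p. 122, Conj. 1.11; tree p734566 (GEN 8), `NarrowFukudaRankProofs` (this seat).
-/

set_option autoImplicit false
-- sibling precedent (`…ConjATwoOfNarrowMu.lean`): the directory name repeats the summit name
set_option linter.dupNamespace false

noncomputable section

open scoped Classical NumberField IntermediateField Polynomial

namespace Summit.BirchSwinnertonDyer.BirchSwinnertonDyer.Theorems.SteinbergFibreAtTwo.NarrowRankCert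

open WeierstrassCurve NumberField IsDedekindDomain Field Polynomial
open Literature.NumberTheory.EllipticCurves Literature.NumberTheory.EllipticCurves.ZpExtension
  Literature.NumberTheory.GaloisRepresentations Literature.NumberTheory.IwasawaTheory Literature.NumberTheory.NumberFields
  Literature.NumberTheory.EllipticCurves.Rank1Residual
open Summit.BirchSwinnertonDyer.BirchSwinnertonDyer.Theorems.AlignedTransportAtTwoTorsionPointField
open Summit.BirchSwinnertonDyer.BirchSwinnertonDyer.Theorems.SteinbergFibreAtTwo
open Summit.BirchSwinnertonDyer.BirchSwinnertonDyer.Theses.ByReductionTypeAtTwo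

/-! ## §1 Statement (A) at `(W, 2)` from a narrow rank certificate of an odd-degree point field — ANY sign of `Δ` -/

section PointField

variable (W : WeierstrassCurve ℚ) [W.IsElliptic]

/-- **(A) at `(W, 2)` from a NARROW RANK CERTIFICATE of the point field `ℚ(P)`** (`W/ℚ` elliptic, `P ∈ W[2] ∖ 0`, `[ℚ(P) : ℚ]` odd): if for some
`n₀, B` every cyclotomic `ℤ₂`-extension `κP` of `ℚ(P) = ℚ̄^{Stab P}` has Fukuda index `n₀`, `rank₂ Cl⁺(ℚ(P)_{n₀+1}) = rank₂ Cl⁺(ℚ(P)_{n₀})` and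
`rank₂ Cl⁺(ℚ(P)_m) ≤ B` for `m ≤ n₀` (narrow `2`-ranks as the indices `[Cl⁺ : (Cl⁺)²]`, for any `NumberField` instance on the layers), then for every
cyclotomic `ℤ₂`-extension `κ` of `ℚ` some `FineSelmerDualData` of `W` has `X` finitely generated over `ℤ₂`.  NARROW FUKUDA
(`NarrowFukuda.narrowMu_of_narrowRankCertificate`) ⟹ (a) ∧ (b) with `D = B` ⟹ GEN 8's `NarrowMu.conjA_two_of_narrowMu_pointField`.
[cite: Fukuda1994, Thm. 1 (2), p. 264] [cite: CoatesSujatha2005, Conj. A and Thm. 3.4] [cite: Kida1982JFields, main theorem (μ-part; shape only)] -/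
theorem conjA_two_of_narrowRankCertificate_pointField {P : geomTorsion W 2} (hP : P ≠ 0)
    (hodd : Odd (Module.finrank ℚ ↥(IntermediateField.fixedField (MulAction.stabilizer (absoluteGaloisGroup ℚ) P))))
    (n₀ B : ℕ)
    (hcert : ∀ κP : ZpExtension ↥(IntermediateField.fixedField (MulAction.stabilizer (absoluteGaloisGroup ℚ) P)) 2,
      κP.IsCyclotomic →
        TotallyRamifiedFrom κP n₀ ∧
        (∀ [NumberField ↥(κP.layer n₀)] [NumberField ↥(κP.layer (n₀ + 1))],
          (powMonoidHom (α := NarrowClassGroup ↥(κP.layer (n₀ + 1))) 2).range.index =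
            (powMonoidHom (α := NarrowClassGroup ↥(κP.layer n₀)) 2).range.index) ∧
        (∀ m : ℕ, m ≤ n₀ → ∀ [NumberField ↥(κP.layer m)],
          padicValNat 2 (powMonoidHom (α := NarrowClassGroup ↥(κP.layer m)) 2).range.index ≤ B))
    (κ : ZpExtension ℚ 2) (hκ : κ.IsCyclotomic) :
    ∃ (γ : absoluteGaloisGroup ℚ) (Dd : W.FineSelmerDualData κ γ),
      Module.Finite ℤ_[2] (RestrictScalars ℤ_[2] (IwasawaAlgebra 2) Dd.X) := by
  haveI : FiniteDimensional ℚ ↥(IntermediateField.fixedField (MulAction.stabilizer (absoluteGaloisGroup ℚ) P)) :=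
    finiteDimensional_fixedField_stabilizer W P
  haveI : NumberField ↥(IntermediateField.fixedField (MulAction.stabilizer (absoluteGaloisGroup ℚ) P)) :=
    NumberField.of_module_finite ℚ _
  obtain ⟨hμ, hδ⟩ := NarrowFukuda.narrowMu_of_narrowRankCertificate
    (↥(IntermediateField.fixedField (MulAction.stabilizer (absoluteGaloisGroup ℚ) P))) n₀ B hcert
  exact NarrowMu.conjA_two_of_narrowMu_pointField W hP hodd hμ B hδ κ hκ

end PointField

/-! ## §2 The Q⁺ road: `FineSelmerConjATwoOrdPosDisc` from narrow rank certificates on the `0 < Δ` cell -/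

/-- **ROAD INTO Q⁺ `FineSelmerConjATwoOrdPosDisc` FROM NARROW RANK CERTIFICATES — KERNEL.** If at every curve of the cell [non-CM, analytic rank `0`,
good ordinary at `2`, `ρ̄_{W,2}` onto, `0 < Δ`] SOME non-zero `P ∈ W[2]` carries a narrow rank certificate `(n₀, B)` for the totally real cubic
`ℚ(P) = ℚ̄^{Stab P}` (Fukuda index `n₀`, `rank₂ Cl⁺(ℚ(P)_{n₀+1}) = rank₂ Cl⁺(ℚ(P)_{n₀})`, `rank₂ Cl⁺(ℚ(P)_m) ≤ B` for `m ≤ n₀`, for every cyclotomic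
`ℤ₂`-extension of `ℚ(P)`), then `FineSelmerConjATwoOrdPosDisc` (the (A)₂-half of G11⁺ = Greenberg's Conj. 1.11 at `2` on the cell).  Prices the
`∀ n` input «narrow `μ₂(ℚ(P)) = 0`» of GEN 8's road one level lower: two finite narrow class-group computations per curve when `n₀ = 0`.
Nothing is asserted about any curve. [cite: Fukuda1994, Thm. 1 (2), p. 264] [cite: CoatesSujatha2005, Conj. A] [cite: GreenbergLNM1716, Conj. 1.11 and p. 122] -/
theorem fineSelmerConjATwoOrdPosDisc_of_narrowRankCertificate
    (hIw : ∀ (W : WeierstrassCurve ℚ) [W.IsElliptic] [W.IsGloballyMinimal], ¬ W.HasCM → W.analyticRank = 0 →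
      GoodOrd W 2 → W.HasSurjectiveModNGaloisRep 2 → 0 < W.Δ →
      ∃ (P : geomTorsion W 2) (n₀ B : ℕ), P ≠ 0 ∧
        ∀ κP : ZpExtension ↥(IntermediateField.fixedField (MulAction.stabilizer (absoluteGaloisGroup ℚ) P)) 2,
          κP.IsCyclotomic →
            TotallyRamifiedFrom κP n₀ ∧
            (∀ [NumberField ↥(κP.layer n₀)] [NumberField ↥(κP.layer (n₀ + 1))],
              (powMonoidHom (α := NarrowClassGroup ↥(κP.layer (n₀ + 1))) 2).range.index =
                (powMonoidHom (α := NarrowClassGroup ↥(κP.layer n₀)) 2).range.index) ∧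
            (∀ m : ℕ, m ≤ n₀ → ∀ [NumberField ↥(κP.layer m)],
              padicValNat 2 (powMonoidHom (α := NarrowClassGroup ↥(κP.layer m)) 2).range.index ≤ B)) :
    FineSelmerConjATwoOrdPosDisc := by
  intro W _ _ hcm hr hgo h2 hΔ κ hκ
  obtain ⟨P, n₀, B, hP, hcert⟩ := hIw W hcm hr hgo h2 hΔ
  have h3 : Module.finrank ℚ ↥(IntermediateField.fixedField (MulAction.stabilizer (absoluteGaloisGroup ℚ) P)) = 3 :=
    finrank_fixedField_stabilizer_eq_three_of_irreducible W (hasIrreducibleModPGaloisRep_of_hasSurjectiveModNGaloisRep W 2 h2) hP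
  exact conjA_two_of_narrowRankCertificate_pointField W hP (by rw [h3]; decide) n₀ B hcert κ hκ

/-! ## §3 The cubic-model door (census currency of C1″ / C4″ / k4: `y² = x³ + px² + qx + r`, `β` a root) -/

/-- **(A) at `2` for `y² = x³ + px² + qx + r` (`p, q, r ∈ ℤ`, IRREDUCIBLE cubic, `β ∈ ℚ̄` a root) from a NARROW RANK CERTIFICATE of the cubic field
`ℚ(β)`** — ANY sign of the discriminant: Fukuda index `n₀`, `rank₂ Cl⁺(ℚ(β)_{n₀+1}) = rank₂ Cl⁺(ℚ(β)_{n₀})`, `rank₂ Cl⁺(ℚ(β)_m) ≤ B` (`m ≤ n₀`) for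
every cyclotomic `ℤ₂`-extension of `ℚ(β)` ⟹ for every cyclotomic `κ` of `ℚ` some `FineSelmerDualData` of `⟨0, p, 0, q, r⟩` has `X` finitely generated
over `ℤ₂`.  NARROW FUKUDA + GEN 8's `NarrowMu.conjA_two_cubicModel_of_narrowMu`.  For `disc < 0` the (b)-free GEN 7 door is stronger; for
`disc > 0` (three real places) this replaces the `∀ n` narrow-defect hypothesis by two narrow class-group computations when `n₀ = 0`
(`ℚ(β)` and `ℚ(β, √2)`). [cite: Fukuda1994, Thm. 1 (2), p. 264] [cite: CoatesSujatha2005, Conj. A and Thm. 3.4] [cite: Kida1982JFields, main theorem (μ-part; shape only)] -/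
theorem conjA_two_cubicModel_of_narrowRankCertificate (p q r : ℤ)
    [((⟨0, (p : ℚ), 0, (q : ℚ), (r : ℚ)⟩ : WeierstrassCurve ℚ)).IsElliptic]
    (hirr : Irreducible (Cubic.toPoly ⟨1, (p : ℚ), q, r⟩))
    {β : AlgebraicClosure ℚ} (hβ : aeval β (Cubic.toPoly ⟨1, (p : ℚ), q, r⟩) = 0)
    (n₀ B : ℕ)
    (hcert : ∀ κP : ZpExtension ↥(IntermediateField.adjoin ℚ ({β} : Set (AlgebraicClosure ℚ))) 2, κP.IsCyclotomic →
      TotallyRamifiedFrom κP n₀ ∧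
      (∀ [NumberField ↥(κP.layer n₀)] [NumberField ↥(κP.layer (n₀ + 1))],
        (powMonoidHom (α := NarrowClassGroup ↥(κP.layer (n₀ + 1))) 2).range.index =
          (powMonoidHom (α := NarrowClassGroup ↥(κP.layer n₀)) 2).range.index) ∧
      (∀ m : ℕ, m ≤ n₀ → ∀ [NumberField ↥(κP.layer m)],
        padicValNat 2 (powMonoidHom (α := NarrowClassGroup ↥(κP.layer m)) 2).range.index ≤ B))
    (κ : ZpExtension ℚ 2) (hκ : κ.IsCyclotomic) :
    ∃ (γ : absoluteGaloisGroup ℚ) (Dd : ((⟨0, (p : ℚ), 0, (q : ℚ), (r : ℚ)⟩ : WeierstrassCurve ℚ)).FineSelmerDualData κ γ),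
      Module.Finite ℤ_[2] (RestrictScalars ℤ_[2] (IwasawaAlgebra 2) Dd.X) := by
  -- `ℚ(β)` is a number field (`β` integral over `ℚ`)
  have hmonic : (Cubic.toPoly ⟨1, (p : ℚ), q, r⟩).Monic := Cubic.monic_of_a_eq_one rfl
  have hβint : IsIntegral ℚ β := ⟨_, hmonic, by rwa [← aeval_def]⟩
  haveI : FiniteDimensional ℚ ↥(IntermediateField.adjoin ℚ ({β} : Set (AlgebraicClosure ℚ))) :=
    IntermediateField.adjoin.finiteDimensional hβint
  haveI : NumberField ↥(IntermediateField.adjoin ℚ ({β} : Set (AlgebraicClosure ℚ))) := NumberField.of_module_finite ℚ _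
  obtain ⟨hμ, hδ⟩ := NarrowFukuda.narrowMu_of_narrowRankCertificate
    (↥(IntermediateField.adjoin ℚ ({β} : Set (AlgebraicClosure ℚ)))) n₀ B hcert
  exact NarrowMu.conjA_two_cubicModel_of_narrowMu p q r hirr hβ hμ B hδ κ hκ

/-! ## §4 The same doors with CONCRETE MODELS at `n₀ = 0`: `rank₂ Cl⁺(ℚ(P)(√2)) = rank₂ Cl⁺(ℚ(P))` -/

section Models

variable (W : WeierstrassCurve ℚ) [W.IsElliptic]

/-- **(A) at `(W, 2)` from ONE equality of narrow `2`-ranks** (`W/ℚ` elliptic, `P ∈ W[2] ∖ 0`, `[ℚ(P) : ℚ]` odd): if every cyclotomic `ℤ₂`-extension of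
`F = ℚ(P) = ℚ̄^{Stab P}` has Fukuda index `0` (tree criteria: `forall_totallyRamifiedFrom_zero_of_not_dvd_discr` for `2 ∤ d_F`,
`totallyRamifiedFrom_zero_of_evenIndexCertificate`), and some quadratic extension `L/F` containing a square root `θ` of `2` (a model of `F(√2) = F_1`) has
`[Cl⁺(L) : Cl⁺(L)²] = [Cl⁺(F) : Cl⁺(F)²]`, then for every cyclotomic `ℤ₂`-extension `κ` of `ℚ` some `FineSelmerDualData` of `W` has `X` finitely
generated over `ℤ₂`.  `NarrowFukuda.narrowMu_of_layerOne_model` + GEN 8's `NarrowMu.conjA_two_of_narrowMu_pointField`.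
[cite: Fukuda1994, Thm. 1 (2), p. 264] [cite: Washington1997, §13.1] [cite: CoatesSujatha2005, Conj. A and Thm. 3.4] -/
theorem conjA_two_of_narrowRank_sqrtTwo_model_pointField {P : geomTorsion W 2} (hP : P ≠ 0)
    (hodd : Odd (Module.finrank ℚ ↥(IntermediateField.fixedField (MulAction.stabilizer (absoluteGaloisGroup ℚ) P))))
    (h0 : ∀ κP : ZpExtension ↥(IntermediateField.fixedField (MulAction.stabilizer (absoluteGaloisGroup ℚ) P)) 2,
      κP.IsCyclotomic → TotallyRamifiedFrom κP 0)
    [NumberField ↥(IntermediateField.fixedField (MulAction.stabilizer (absoluteGaloisGroup ℚ) P))]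
    (L : Type) [Field L] [NumberField L] [Algebra ↥(IntermediateField.fixedField (MulAction.stabilizer (absoluteGaloisGroup ℚ) P)) L]
    (hL : Module.finrank ↥(IntermediateField.fixedField (MulAction.stabilizer (absoluteGaloisGroup ℚ) P)) L = 2) (θ : L) (hθ : θ ^ 2 = 2)
    (hr : (powMonoidHom (α := NarrowClassGroup L) 2).range.index =
      (powMonoidHom (α := NarrowClassGroup ↥(IntermediateField.fixedField (MulAction.stabilizer (absoluteGaloisGroup ℚ) P))) 2).range.index)
    (κ : ZpExtension ℚ 2) (hκ : κ.IsCyclotomic) :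
    ∃ (γ : absoluteGaloisGroup ℚ) (Dd : W.FineSelmerDualData κ γ),
      Module.Finite ℤ_[2] (RestrictScalars ℤ_[2] (IwasawaAlgebra 2) Dd.X) := by
  obtain ⟨hμ, hδ⟩ := NarrowFukuda.narrowMu_of_layerOne_model
    (↥(IntermediateField.fixedField (MulAction.stabilizer (absoluteGaloisGroup ℚ) P))) hodd h0 L hL θ hθ hr
  exact NarrowMu.conjA_two_of_narrowMu_pointField W hP hodd hμ _ hδ κ hκ

end Models

/-- **(A) at `2` for `y² = x³ + px² + qx + r` (irreducible, `β` a root) from ONE equality of narrow `2`-ranks: `rank₂ Cl⁺(ℚ(β)(√2)) = rank₂ Cl⁺(ℚ(β))`** —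
the census currency of C1″/C4″/k4 on the `Δ_cubic > 0` rows: Fukuda index `0` for every cyclotomic `ℤ₂`-extension of `ℚ(β)` (tree criteria), a model
`L ⊇ ℚ(β)` of `ℚ(β, √2)` (`[L : ℚ(β)] = 2`, `θ² = 2`) with `[Cl⁺(L) : Cl⁺(L)²] = [Cl⁺(ℚ(β)) : Cl⁺(ℚ(β))²]` ⟹ (A)₂ for `⟨0, p, 0, q, r⟩` at every cyclotomic `κ`.
`NarrowFukuda.narrowMu_of_layerOne_model` + GEN 8's `NarrowMu.conjA_two_cubicModel_of_narrowMu`. Nothing is asserted about any curve.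
[cite: Fukuda1994, Thm. 1 (2), p. 264] [cite: Washington1997, §13.1] [cite: CoatesSujatha2005, Conj. A and Thm. 3.4] -/
theorem conjA_two_cubicModel_of_narrowRank_sqrtTwo_model (p q r : ℤ)
    [((⟨0, (p : ℚ), 0, (q : ℚ), (r : ℚ)⟩ : WeierstrassCurve ℚ)).IsElliptic]
    (hirr : Irreducible (Cubic.toPoly ⟨1, (p : ℚ), q, r⟩))
    {β : AlgebraicClosure ℚ} (hβ : aeval β (Cubic.toPoly ⟨1, (p : ℚ), q, r⟩) = 0)
    (h0 : ∀ κP : ZpExtension ↥(IntermediateField.adjoin ℚ ({β} : Set (AlgebraicClosure ℚ))) 2, κP.IsCyclotomic → TotallyRamifiedFrom κP 0)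
    [NumberField ↥(IntermediateField.adjoin ℚ ({β} : Set (AlgebraicClosure ℚ)))]
    (L : Type) [Field L] [NumberField L] [Algebra ↥(IntermediateField.adjoin ℚ ({β} : Set (AlgebraicClosure ℚ))) L]
    (hL : Module.finrank ↥(IntermediateField.adjoin ℚ ({β} : Set (AlgebraicClosure ℚ))) L = 2) (θ : L) (hθ : θ ^ 2 = 2)
    (hr : (powMonoidHom (α := NarrowClassGroup L) 2).range.index =
      (powMonoidHom (α := NarrowClassGroup ↥(IntermediateField.adjoin ℚ ({β} : Set (AlgebraicClosure ℚ)))) 2).range.index)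
    (κ : ZpExtension ℚ 2) (hκ : κ.IsCyclotomic) :
    ∃ (γ : absoluteGaloisGroup ℚ) (Dd : ((⟨0, (p : ℚ), 0, (q : ℚ), (r : ℚ)⟩ : WeierstrassCurve ℚ)).FineSelmerDualData κ γ),
      Module.Finite ℤ_[2] (RestrictScalars ℤ_[2] (IwasawaAlgebra 2) Dd.X) := by
  -- `ℚ(β)` is a cubic number field
  have hmonic : (Cubic.toPoly ⟨1, (p : ℚ), q, r⟩).Monic := Cubic.monic_of_a_eq_one rfl
  have hβint : IsIntegral ℚ β := ⟨_, hmonic, by rwa [← aeval_def]⟩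
  have h3 : Module.finrank ℚ ↥(IntermediateField.adjoin ℚ ({β} : Set (AlgebraicClosure ℚ))) = 3 := by
    rw [IntermediateField.adjoin.finrank hβint, ← minpoly.eq_of_irreducible_of_monic hirr hβ hmonic]
    exact Cubic.natDegree_of_a_ne_zero' one_ne_zero
  have hodd : Odd (Module.finrank ℚ ↥(IntermediateField.adjoin ℚ ({β} : Set (AlgebraicClosure ℚ)))) := by
    rw [h3]; decide
  obtain ⟨hμ, hδ⟩ := NarrowFukuda.narrowMu_of_layerOne_model
    (↥(IntermediateField.adjoin ℚ ({β} : Set (AlgebraicClosure ℚ)))) hodd h0 L hL θ hθ hr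
  exact NarrowMu.conjA_two_cubicModel_of_narrowMu p q r hirr hβ hμ _ hδ κ hκ

end Summit.BirchSwinnertonDyer.BirchSwinnertonDyer.Theorems.SteinbergFibreAtTwo.NarrowRankCert

end
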